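import Literature.Probability.LatticeModels.ConformalCovariance
import HarnessLib

/-!
# Objects of the line `one-map-one-jet` for the crux `MoebiusLimitExists`
(item stmt-CriticalPhenomena-1344; `Summit.CriticalPhenomena.Ising3DConformalLimit.Theses.PerfectScreening.MoebiusLimitExists`
= `…Theses.EnergyNotSigmaSquared.MoebiusLimit`, one term)

Route-posited objects (D-0016: definitions a route/line posits live in a reviewed `…Defs` file, never
inside a proof file). The line (checked skeleton `Cruxes/MoebiusLimitExists/Lines/one-map-one-jet.lean`,
planner `planner-cruxplan-stmt-CriticalPhenomena-1344-one-map-one-jet-0`; lead `prover-line-stmt-CriticalPhenomena-1344-c5-0`)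
takes the witness `S` of the existence item stmt-CriticalPhenomena-1981 (a normalised, non-degenerate,
translation-invariant, scale-covariant pointwise scaling limit of the critical `ℤ³` Ising correlators,
NO rotations) and reduces clause (ii) of the crux (Möbius covariance) to the vanishing of the GERM of the
inversion defect `D_n(x) = S n (ι x) − (∏ ‖x i‖^{2Δ}) S n x` at one doubly-good configuration (per
path-component), through real-analyticity of `S n` on the GOOD configurations of the nine-mirror (`B₃`)
arrangement; rotations then follow from inversion + translations (item stmt-CriticalPhenomena-4675,
`PositivityBegetsConformality.InversionBegetsRotations`, proved).

Contents: `invCfg` (the unit inversion `ι = EuclideanGeometry.inversion 0 1` applied pointwise),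
`inversionDefect`, `PuncturedNonCoincident`, `mirrorNormals` (the nine lattice mirror normals
`e_i, e_i ± e_j`), `GoodConfig`, `InvGoodConfig`, the explicit ray configuration `rayCfg`, and their
elementary API: `isInversionCovariant_iff_inversionDefect` (the tree predicate `IsInversionCovariant` IS
"`D_n = 0` off the pole"), `inversionDefect_eq_zero_of_norm_eq_one` (ORDER 0 IS FREE on the fixed unit
sphere of `ι`), involutivity/injectivity of `invCfg`, and `rayCfg_mem_invGoodConfig` (the doubly-good
sets are non-empty for every `n`). Everything here is definitional bookkeeping; the mathematics of the
line is in the stub files `Theorems/EnergyNotSigmaSquaredMoebiusLimitExistsOneMapOneJet*.lean` that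
import this module.

References: Möbius covariance and the unit inversion as in Di Francesco–Mathieu–Sénéchal 1997 §4.1,
§4.3.1 (tree `Literature.Probability.LatticeModels.ConformalCovariance`); the nine mirrors are the `B₃`
arrangement of route HyperoctahedralRP (`HRP2Rigidity`, `CriticalCorrNineMirrorRP`; FILS 1978 §3).
-/

noncomputable section

open Set Function EuclideanGeometry
open Literature.Probability.LatticeModels

namespace Summit.CriticalPhenomena.Ising3DConformalLimit.MoebiusLimitExistsOneMapOneJet

/-! ### The unit inversion on configurations and the inversion defect -/

/-- The unit inversion `ι = inversion 0 1 : x ↦ x / ‖x‖²` applied to every point of a configuration.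
[cite: FrancescoMathieuSenechal1997, §4.1 eq. (4.15)] -/
def invCfg {n : ℕ} (x : Fin n → EuclideanSpace ℝ (Fin 3)) : Fin n → EuclideanSpace ℝ (Fin 3) :=
  fun i => inversion 0 1 (x i)

/-- The INVERSION DEFECT of a family `S` with weight `Δ` at order `n`:
`D_n(x) = S n (ι x) − (∏ ‖x i‖^{2Δ}) · S n x`. `IsInversionCovariant Δ S` says exactly that `D_n = 0`
at every configuration avoiding the pole `0` (`isInversionCovariant_iff_inversionDefect`).
[cite: FrancescoMathieuSenechal1997, §4.3.1 eq. (4.62)] -/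
def inversionDefect (Δ : ℝ) (S : CorrFamily 3) (n : ℕ) (x : Fin n → EuclideanSpace ℝ (Fin 3)) : ℝ :=
  S n (invCfg x) - (∏ i, ‖x i‖ ^ (2 * Δ)) * S n x

/-- Non-coincident configurations avoiding the pole `0` of `ι`. [folklore] -/
def PuncturedNonCoincident (n : ℕ) : Set (Fin n → EuclideanSpace ℝ (Fin 3)) :=
  {x | x ∈ NonCoincident 3 n ∧ ∀ i, x i ≠ 0}

/-! ### The nine-mirror arrangement and good configurations -/

/-- The nine lattice mirror normals `e_i`, `e_i + e_j`, `e_i − e_j` (`i ≠ j`): the `B₃` arrangement,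
exactly the normals of `HyperoctahedralRP.HRP2Rigidity` / `CriticalCorrNineMirrorRP`. [cite: FrohlichEtAl1978, §3 Thm 3.1] -/
def mirrorNormals : Set (EuclideanSpace ℝ (Fin 3)) :=
  {v | ∃ i j : Fin 3, i ≠ j ∧ (v = EuclideanSpace.single i 1 ∨
      v = EuclideanSpace.single i 1 + EuclideanSpace.single j 1 ∨
      v = EuclideanSpace.single i 1 - EuclideanSpace.single j 1)}

/-- GOOD configurations: non-coincident, and there are three linearly independent mirror normals along
each of which the `n` projections `i ↦ ⟪x i, v⟫` are pairwise distinct (three independent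
Osterwalder–Schrader "time" directions in which all points have distinct times). [folklore] -/
def GoodConfig (n : ℕ) : Set (Fin n → EuclideanSpace ℝ (Fin 3)) :=
  {x | x ∈ NonCoincident 3 n ∧ ∃ v : Fin 3 → EuclideanSpace ℝ (Fin 3), LinearIndependent ℝ v ∧
      (∀ a, v a ∈ mirrorNormals) ∧ ∀ a, Function.Injective (fun i => inner ℝ (x i) (v a))}

/-- DOUBLY-GOOD punctured configurations: all points avoid the pole and both `x` and `ι x` are good —
the natural real-analyticity domain of the inversion defect. [folklore] -/
def InvGoodConfig (n : ℕ) : Set (Fin n → EuclideanSpace ℝ (Fin 3)) :=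
  {x | (∀ i, x i ≠ 0) ∧ x ∈ GoodConfig n ∧ invCfg x ∈ GoodConfig n}

/-- The RAY configuration `i ↦ (i + 1) • p₀` on the open ray through `p₀ = e₀ + 2e₁ + 4e₂` (a vector
off all nine mirrors): an explicit doubly-good punctured configuration for every `n`
(`rayCfg_mem_invGoodConfig`). [folklore] -/
def rayCfg (n : ℕ) : Fin n → EuclideanSpace ℝ (Fin 3) :=
  fun i => ((i : ℕ) + 1 : ℝ) •
    (EuclideanSpace.single 0 1 + (2 : ℝ) • EuclideanSpace.single 1 1 + (4 : ℝ) • EuclideanSpace.single 2 1)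

/-! ### Elementary API -/

/-- Coordinates of `invCfg`. [folklore] -/
@[simp] theorem invCfg_apply {n : ℕ} (x : Fin n → EuclideanSpace ℝ (Fin 3)) (i : Fin n) :
    invCfg x i = inversion 0 1 (x i) := rfl

/-- The unit inversion of `ℝ³` is `x ↦ ‖x‖⁻² • x`. [cite: FrancescoMathieuSenechal1997, §4.1 eq. (4.15)] -/
theorem inversion_zero_one_eq_smul (p : EuclideanSpace ℝ (Fin 3)) :
    inversion (0 : EuclideanSpace ℝ (Fin 3)) 1 p = (‖p‖ ^ 2)⁻¹ • p := by
  simp [inversion]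

/-- `ι` is an involution: `invCfg (invCfg x) = x`. [folklore] -/
@[simp] theorem invCfg_invCfg {n : ℕ} (x : Fin n → EuclideanSpace ℝ (Fin 3)) : invCfg (invCfg x) = x := by
  funext i
  simp [invCfg, inversion_inversion]

/-- `invCfg` preserves non-coincidence (the unit inversion is injective on all of `ℝ³`). [folklore] -/
theorem invCfg_mem_nonCoincident_iff {n : ℕ} (x : Fin n → EuclideanSpace ℝ (Fin 3)) :
    invCfg x ∈ NonCoincident 3 n ↔ x ∈ NonCoincident 3 n := by
  rw [mem_nonCoincident, mem_nonCoincident]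
  exact (inversion_injective (0 : EuclideanSpace ℝ (Fin 3)) one_ne_zero).of_comp_iff x

/-- `invCfg` preserves avoidance of the pole. [folklore] -/
theorem invCfg_ne_zero {n : ℕ} {x : Fin n → EuclideanSpace ℝ (Fin 3)} (hx : ∀ i, x i ≠ 0) (i : Fin n) :
    invCfg x i ≠ 0 := by
  rw [invCfg_apply, Ne, inversion_eq_center one_ne_zero]
  exact hx i

/-- Membership in `PuncturedNonCoincident`. [folklore] -/
@[simp] theorem mem_puncturedNonCoincident {n : ℕ} (x : Fin n → EuclideanSpace ℝ (Fin 3)) :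
    x ∈ PuncturedNonCoincident n ↔ x ∈ NonCoincident 3 n ∧ ∀ i, x i ≠ 0 := Iff.rfl

/-- Membership in `InvGoodConfig`. [folklore] -/
@[simp] theorem mem_invGoodConfig {n : ℕ} (x : Fin n → EuclideanSpace ℝ (Fin 3)) :
    x ∈ InvGoodConfig n ↔ (∀ i, x i ≠ 0) ∧ x ∈ GoodConfig n ∧ invCfg x ∈ GoodConfig n := Iff.rfl

/-- Good configurations are non-coincident. [folklore] -/
theorem GoodConfig.nonCoincident {n : ℕ} {x : Fin n → EuclideanSpace ℝ (Fin 3)} (hx : x ∈ GoodConfig n) :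
    x ∈ NonCoincident 3 n := hx.1

/-- Doubly-good configurations are punctured non-coincident. [folklore] -/
theorem invGoodConfig_subset_punctured (n : ℕ) : InvGoodConfig n ⊆ PuncturedNonCoincident n :=
  fun _ hx => ⟨hx.2.1.1, hx.1⟩

/-- `InvGoodConfig` is `ι`-invariant. [folklore] -/
theorem invCfg_mem_invGoodConfig {n : ℕ} {x : Fin n → EuclideanSpace ℝ (Fin 3)} (hx : x ∈ InvGoodConfig n) :
    invCfg x ∈ InvGoodConfig n :=
  ⟨invCfg_ne_zero hx.1, hx.2.2, by simpa using hx.2.1⟩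

/-- **The tree predicate `IsInversionCovariant` is the vanishing of the inversion defect off the pole.**
[cite: FrancescoMathieuSenechal1997, §4.3.1 eq. (4.62)] -/
theorem isInversionCovariant_iff_inversionDefect (Δ : ℝ) (S : CorrFamily 3) :
    IsInversionCovariant Δ S ↔
      ∀ n (x : Fin n → EuclideanSpace ℝ (Fin 3)), (∀ i, x i ≠ 0) → inversionDefect Δ S n x = 0 := by
  simp only [IsInversionCovariant, inversionDefect, sub_eq_zero]
  rfl

/-- **Order 0 is free**: on the fixed unit sphere of `ι` the inversion defect vanishes identically
(`ι x = x`, all weights `1`), for EVERY family `S` and weight `Δ`. [folklore] -/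
theorem inversionDefect_eq_zero_of_norm_eq_one (Δ : ℝ) (S : CorrFamily 3) {n : ℕ}
    {x : Fin n → EuclideanSpace ℝ (Fin 3)} (hx : ∀ i, ‖x i‖ = 1) : inversionDefect Δ S n x = 0 := by
  have h1 : invCfg x = x := by
    funext i
    exact inversion_of_mem_sphere (by simp [hx i])
  have h2 : (∏ i, ‖x i‖ ^ (2 * Δ)) = 1 := by
    simp [hx]
  simp [inversionDefect, h1, h2]

/-- The coordinate vectors `e_a` are mirror normals. [cite: FrohlichEtAl1978, §3 Thm 3.1] -/
theorem single_mem_mirrorNormals (a : Fin 3) : EuclideanSpace.single a (1 : ℝ) ∈ mirrorNormals := by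
  obtain ⟨b, hb⟩ : ∃ b : Fin 3, a ≠ b := by
    fin_cases a
    · exact ⟨1, by decide⟩
    · exact ⟨0, by decide⟩
    · exact ⟨0, by decide⟩
  exact ⟨a, b, hb, Or.inl rfl⟩

/-- The coordinate frame `a ↦ e_a` is linearly independent. [folklore] -/
theorem linearIndependent_single :
    LinearIndependent ℝ (fun a : Fin 3 => EuclideanSpace.single a (1 : ℝ)) := by
  have heq : (fun a : Fin 3 => EuclideanSpace.single a (1 : ℝ)) = ⇑(EuclideanSpace.basisFun (Fin 3) ℝ) := by
    funext a
    exact (EuclideanSpace.basisFun_apply _ _ a).symm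
  rw [heq, ← OrthonormalBasis.coe_toBasis]
  exact (EuclideanSpace.basisFun (Fin 3) ℝ).toBasis.linearIndependent

/-- The base vector `p₀ = e₀ + 2e₁ + 4e₂` of `rayCfg`. [folklore] -/
def rayBase : EuclideanSpace ℝ (Fin 3) :=
  EuclideanSpace.single 0 1 + (2 : ℝ) • EuclideanSpace.single 1 1 + (4 : ℝ) • EuclideanSpace.single 2 1

/-- `rayCfg n i = (i + 1) • p₀`. [folklore] -/
theorem rayCfg_apply (n : ℕ) (i : Fin n) : rayCfg n i = ((i : ℕ) + 1 : ℝ) • rayBase := rfl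

/-- The coordinates of `p₀` are `1, 2, 4` — all non-zero. [folklore] -/
theorem rayBase_apply_ne_zero (a : Fin 3) : rayBase a ≠ 0 := by
  fin_cases a <;> simp [rayBase]

/-- `p₀ ≠ 0`. [folklore] -/
theorem rayBase_ne_zero : rayBase ≠ 0 := by
  intro h
  have := rayBase_apply_ne_zero 0
  rw [h] at this
  exact this rfl

/-- A configuration `i ↦ c i • p₀` on the punctured LINE through `p₀` with pairwise distinct non-zero
coefficients is good: the coordinate frame separates its points. [folklore] -/
theorem smul_rayBase_mem_goodConfig {n : ℕ} {c : Fin n → ℝ} (hc : Function.Injective c) :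
    (fun i => c i • rayBase) ∈ GoodConfig n := by
  refine ⟨?_, fun a => EuclideanSpace.single a 1, linearIndependent_single, single_mem_mirrorNormals, ?_⟩
  · rw [mem_nonCoincident]
    intro i j hij
    have h := congrArg (fun p : EuclideanSpace ℝ (Fin 3) => p 0) hij
    simp only [PiLp.smul_apply, smul_eq_mul] at h
    exact hc (mul_right_cancel₀ (rayBase_apply_ne_zero 0) h)
  · intro a i j hij
    simp only [EuclideanSpace.inner_single_right, PiLp.smul_apply, smul_eq_mul, one_mul, conj_trivial] at hij
    exact hc (mul_right_cancel₀ (rayBase_apply_ne_zero a) hij)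

/-- The unit inversion of `c • p₀` (`c ≠ 0`) is `(c ‖p₀‖²)⁻¹ • p₀`. [folklore] -/
theorem inversion_smul_rayBase {c : ℝ} (hc : c ≠ 0) :
    inversion (0 : EuclideanSpace ℝ (Fin 3)) 1 (c • rayBase) = (c * ‖rayBase‖ ^ 2)⁻¹ • rayBase := by
  rw [inversion_zero_one_eq_smul, norm_smul, smul_smul]
  congr 1
  have hp : ‖rayBase‖ ≠ 0 := norm_ne_zero_iff.2 rayBase_ne_zero
  rw [Real.norm_eq_abs, mul_pow, sq_abs]
  field_simp

/-- **The doubly-good sets are non-empty**: `rayCfg n ∈ InvGoodConfig n` for every `n`. [folklore] -/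
theorem rayCfg_mem_invGoodConfig : ∀ n : ℕ, rayCfg n ∈ InvGoodConfig n := by
  intro n
  have hpos : ∀ i : Fin n, (0 : ℝ) < (i : ℕ) + 1 := fun i => by positivity
  have hinj : Function.Injective (fun i : Fin n => ((i : ℕ) + 1 : ℝ)) := by
    intro i j hij
    exact Fin.ext (by exact_mod_cast (add_right_cancel hij : ((i : ℕ) : ℝ) = j))
  refine ⟨fun i => ?_, smul_rayBase_mem_goodConfig hinj, ?_⟩
  · rw [rayCfg_apply]
    exact smul_ne_zero (hpos i).ne' rayBase_ne_zero
  · have hp : 0 < ‖rayBase‖ ^ 2 := by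
      have := norm_pos_iff.2 rayBase_ne_zero
      positivity
    have heq : invCfg (rayCfg n) = fun i : Fin n => ((((i : ℕ) + 1 : ℝ) * ‖rayBase‖ ^ 2)⁻¹) • rayBase := by
      funext i
      rw [invCfg_apply, rayCfg_apply, inversion_smul_rayBase (hpos i).ne']
    rw [heq]
    refine smul_rayBase_mem_goodConfig ?_
    intro i j hij
    have h := inv_injective hij
    exact hinj (mul_right_cancel₀ hp.ne' h)

/-- `InvGoodConfig n` is non-empty. [folklore] -/
theorem invGoodConfig_nonempty (n : ℕ) : (InvGoodConfig n).Nonempty := ⟨rayCfg n, rayCfg_mem_invGoodConfig n⟩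

end Summit.CriticalPhenomena.Ising3DConformalLimit.MoebiusLimitExistsOneMapOneJet

end
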